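import Summits.QuantumFields.YangMills.Theorems.CurvaturePoincareLargeDeviationOfStubs
import Summits.QuantumFields.YangMills.Theorems.CurvaturePoincareStubCurvaturePinning
import HarnessLib

/-!
# K1′ `PoincareLipschitz.MesoscopicConcentrationL` (stmt-QuantumFields-23532) — THE LARGE-DEVIATION REGIME HYPOTHESIS-FREE AND THE K1 FACE v2 «23532 ⟸ MD ALONE»

Cell `ym3-torus` (YM ladder rung R3 = continuum SU(2) Yang–Mills on T³ — a RUNG, NOT d = 4, NOT infinite volume, NOT a mass gap, NOT Clay).
Width seat `ym3-torus-px10` g8 (K30-KNIT file 2); `--supports stmt-QuantumFields-23532 --as helper`; theorems only; one-line compositions over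
* ✓p741739 `…CurvaturePoincareLargeDeviationOfStubs.largeDeviation_of_NP (hNP)` / `mesoscopicResidual_of` / `mesoscopicConcentrationL_of_NP_MD (hNP) (hMD)` (this seat),
* ✓p742671 NP `Summit.QuantumFields.YangMills.Theorems.CurvaturePoincareStubCurvaturePinning.stub_curvaturePinning` (seat ym3-torus-px19 g9, «averaged axial
  gauges» over ✓p742418 `boxUhlenbeck` and px16 g11's door ✓p741185 `pinning_of_boxUhlenbeck`),
* ✓p740183 (K1 face v1), ✓p740923 (LM), ✓p740627 (B♯), ✓`PoincareLipschitzStubBoundedBoxConcentration` (bounded boxes).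

RESULTS (ns `…Theorems.PoincareLipschitzMesoscopicConcentrationLOfModerateDeviation`).
* `largeDeviation` — LINE 30's LARGE-DEVIATION REGIME WITHOUT HYPOTHESES: for every `L` there are `C_th > 0`, `Cc ≥ 0`, `cc > 0`, `γ₁ ∈ (0,1]` such that for
  every box side `1 ≤ n ≤ β_K` and every gauge-invariant box-local Λ-link-Lipschitz `f`:  `C_th·Λ²·n⁵ ≤ β_K·r²  ⟹  μ_K{r ≤ f − ∫f} ≤ Cc·exp(−cc·β_K r²/(n²Λ²))`.
* `mesoscopicResidual_of_moderateDeviation (hMD)` — the v1.1 mesoscopic residual text (R) from the Gaussian window MD alone.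
* ★★★ `mesoscopicConcentrationL_of_moderateDeviation (hMD) : …Theses.PoincareLipschitz.MesoscopicConcentrationL` — THE K1 FACE v2: the crux BY NAME from ONE
  displayed row, MD = `stub_moderateDeviationResidual` (registered text verbatim: boxes `17·L³ < n ≤ β_K` AND `β_K r² ≤ C_th·Λ²·n⁵` — the
  Gaussian-concentration window; XL, organ-adjacent, 0 seats, NOT proved anywhere).

HONEST SCOPE.  Display/bookkeeping; NOTHING of MD, `HistoryTailL` (19936), 23083, EX (19200), 20520, any rung or summit statement is proved.  Sorry-free, axioms standard.

References: T. Bałaban, Commun. Math. Phys. **102** (1985) 255–275 [Balaban1985UV3] ((3) p.256, (7) p.257).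
-/

open scoped BigOperators
open MeasureTheory
open Literature.MathematicalPhysics.QuantumFieldTheory.Balaban1983to89
open Literature.MathematicalPhysics.QuantumFieldTheory.Balaban1983to89.T3ContinuumYM3Torus
open Literature.MathematicalPhysics.QuantumFieldTheory.Balaban1983to89.T3UnitScaleTilt
open Literature.MathematicalPhysics.QuantumFieldTheory.Balaban1983to89.T3UnitLawDensityEML (ℰp)
open Literature.MathematicalPhysics.QuantumFieldTheory.Balaban1983to89.T4AxialGaugeSmallField (boxPlaqs castSite axialGauge)
open Summit.QuantumFields.YangMills.Theorems.CurvaturePoincareLargeDeviationOfStubs (largeDeviation_of_NP mesoscopicResidual_of)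

namespace Summit.QuantumFields.YangMills.Theorems.PoincareLipschitzMesoscopicConcentrationLOfModerateDeviation

/-- ★★★ **LINE 30's LARGE-DEVIATION REGIME, HYPOTHESIS-FREE** (NP ✓p742671 · LM ✓p740923 · B♯ ✓p740627 through ✓p741739 `largeDeviation_of_NP`).
[cite: Balaban1985UV3, (3) p.256, (7) p.257] -/
theorem largeDeviation :
        open Literature.MathematicalPhysics.QuantumFieldTheory.Balaban1983to89 Literature.MathematicalPhysics.QuantumFieldTheory.Balaban1983to89.T3ContinuumYM3Torus in ∀ (L : ℕ), ∃ (Cth : ℝ), 0 < Cth ∧ ∃ (Cc cc : ℝ), 0 ≤ Cc ∧ 0 < cc ∧ ∃ γ₁ : ℝ, 0 < γ₁ ∧ γ₁ ≤ 1 ∧ ∀ (F : T3Family) (γ : ℝ), F.L = L → 0 < γ → γ ≤ γ₁ → ∀ (K n : ℕ), 1 ≤ n → (n : ℝ) ≤ (F.scheme T3UnitLawDensityEML.ℰp γ).β K → 2 * n ≤ (F.P K).sitesPerDir 0 → ∀ (x₀ : Site (F.P K) 0) (f : GaugeField (F.P K) 0 (Matrix.specialUnitaryGroup (Fin 2) ℂ)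 → ℝ) (Λ : ℝ), 0 < Λ → Measurable f → GaugeField.GaugeInvariant f → (∀ U U' : GaugeField (F.P K) 0 (Matrix.specialUnitaryGroup (Fin 2) ℂ), (∀ b : PBond (F.P K) 0, (∀ k, (b.src k - x₀ k).val < n) → (∀ k, (b.tgt k - x₀ k).val < n) → U b = U' b) → f U = f U') → (∀ U U' : GaugeField (F.P K) 0 (Matrix.specialUnitaryGroup (Fin 2) ℂ), |f U - f U'| ≤ Λ * Real.sqrt (∑ b : PBond (F.P K) 0, GaugeGroup.dist1 (U b * (U' b)⁻¹) ^ 2)) → ∀ r : ℝ, 0 ≤ r → Cth * Λ ^ 2 * (n : ℝ) ^ 5 ≤ (F.scheme T3UnitLawDensityEML.ℰp γ).β K * r ^ 2 → (T3UnitScaleTilt.gibbsK F T3UnitLawDensityEML.ℰp γ K).real {U | r ≤ f U - ∫ V, f V ∂(T3UnitScaleTilt.gibbsK F T3UnitLawDensityEML.ℰp γ K)} ≤ Cc * Real.exp (-(cc * (F.scheme T3UnitLawDensityEML.ℰp γ).β K * r ^ 2 / ((n : ℝ) ^ 2 * Λ ^ 2))) :=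
  largeDeviation_of_NP Summit.QuantumFields.YangMills.Theorems.CurvaturePoincareStubCurvaturePinning.stub_curvaturePinning

/-- The v1.1 mesoscopic residual text (R) (= LINE 23's `stub_mesoscopicBoxConcentration`, = row `hR` of ✓p740183) from the Gaussian window MD ALONE. -/
theorem mesoscopicResidual_of_moderateDeviation
    (hMD : open Literature.MathematicalPhysics.QuantumFieldTheory.Balaban1983to89 Literature.MathematicalPhysics.QuantumFieldTheory.Balaban1983to89.T3ContinuumYM3Torus in ∀ (L : ℕ) (Cth : ℝ), 0 < Cth → ∃ (Cc cc : ℝ), 0 ≤ Cc ∧ 0 < cc ∧ ∃ γ₁ : ℝ, 0 < γ₁ ∧ γ₁ ≤ 1 ∧ ∀ (F : T3Family) (γ : ℝ), F.L = L → 0 < γ → γ ≤ γ₁ → ∀ (K n : ℕ), 1 ≤ n → (n : ℝ) ≤ (F.scheme T3UnitLawDensityEML.ℰp γ).β K → 2 * n ≤ (F.P K).sitesPerDir 0 → 17 * L ^ 3 < n → ∀ (x₀ : Site (F.P K) 0) (f : GaugeField (F.P K) 0 (Matrix.specialUnitaryGroup (Fin 2) ℂ) → ℝ) (Λ : ℝ),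 0 < Λ → Measurable f → GaugeField.GaugeInvariant f → (∀ U U' : GaugeField (F.P K) 0 (Matrix.specialUnitaryGroup (Fin 2) ℂ), (∀ b : PBond (F.P K) 0, (∀ k, (b.src k - x₀ k).val < n) → (∀ k, (b.tgt k - x₀ k).val < n) → U b = U' b) → f U = f U') → (∀ U U' : GaugeField (F.P K) 0 (Matrix.specialUnitaryGroup (Fin 2) ℂ), |f U - f U'| ≤ Λ * Real.sqrt (∑ b : PBond (F.P K) 0, GaugeGroup.dist1 (U b * (U' b)⁻¹) ^ 2)) → ∀ r : ℝ, 0 ≤ r → (F.scheme T3UnitLawDensityEML.ℰp γ).β K * r ^ 2 ≤ Cth * Λ ^ 2 * (n : ℝ) ^ 5 → (T3UnitScaleTilt.gibbsK F T3UnitLawDensityEML.ℰp γ K).real {U | r ≤ f U - ∫ V, f V ∂(T3UnitScaleTilt.gibbsK F T3UnitLawDensityEML.ℰp γ K)} ≤ Cc * Real.exp (-(cc * (F.scheme T3UnitLawDensityEML.ℰp γ).β K * r ^ 2 / ((n : ℝ) ^ 2 * Λ ^ 2)))) :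
        open Literature.MathematicalPhysics.QuantumFieldTheory.Balaban1983to89 Literature.MathematicalPhysics.QuantumFieldTheory.Balaban1983to89.T3ContinuumYM3Torus in ∀ (L : ℕ), ∃ (Cc cc : ℝ), 0 ≤ Cc ∧ 0 < cc ∧ ∃ γ₁ : ℝ, 0 < γ₁ ∧ γ₁ ≤ 1 ∧ ∀ (F : T3Family) (γ : ℝ), F.L = L → 0 < γ → γ ≤ γ₁ → ∀ (K n : ℕ), 1 ≤ n → (n : ℝ) ≤ (F.scheme T3UnitLawDensityEML.ℰp γ).β K → 2 * n ≤ (F.P K).sitesPerDir 0 → 17 * L ^ 3 < n → ∀ (x₀ : Site (F.P K) 0) (f : GaugeField (F.P K) 0 (Matrix.specialUnitaryGroup (Fin 2) ℂ) → ℝ) (Λ : ℝ), 0 < Λ → Measurable f → GaugeField.GaugeInvariant f → (∀ U U' : GaugeField (F.P K) 0 (Matrix.specialUnitaryGroup (Fin 2) ℂ), (∀ b : PBond (F.P K) 0, (∀ k, (b.src k - x₀ k).val < n) → (∀ k, (b.tgt k - x₀ k).val < n) → U b = U' b) → f U = f U') → (∀ U U' : GaugeField (F.P K) 0 (Matrix.specialUnitaryGroup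 (Fin 2) ℂ), |f U - f U'| ≤ Λ * Real.sqrt (∑ b : PBond (F.P K) 0, GaugeGroup.dist1 (U b * (U' b)⁻¹) ^ 2)) → ∀ r : ℝ, 0 ≤ r → (T3UnitScaleTilt.gibbsK F T3UnitLawDensityEML.ℰp γ K).real {U | r ≤ f U - ∫ V, f V ∂(T3UnitScaleTilt.gibbsK F T3UnitLawDensityEML.ℰp γ K)} ≤ Cc * Real.exp (-(cc * (F.scheme T3UnitLawDensityEML.ℰp γ).β K * r ^ 2 / ((n : ℝ) ^ 2 * Λ ^ 2))) :=
  mesoscopicResidual_of largeDeviation hMD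

/-- ★★★ **THE K1 FACE v2: `PoincareLipschitz.MesoscopicConcentrationL` (stmt-QuantumFields-23532) BY NAME FROM THE GAUSSIAN WINDOW MD ALONE** —
`hMD` = LINE 30's registered residual `stub_moderateDeviationResidual` verbatim (boxes `17·L³ < n ≤ β_K`, deviations `β_K r² ≤ C_th·Λ²·n⁵`); every other
piece of K1′ (bounded boxes; large deviations on all boxes via NP + LM + B♯) is a tree theorem.  [cite: Balaban1985UV3, (3) p.256, (7) p.257] -/
theorem mesoscopicConcentrationL_of_moderateDeviation
    (hMD : open Literature.MathematicalPhysics.QuantumFieldTheory.Balaban1983to89 Literature.MathematicalPhysics.QuantumFieldTheory.Balaban1983to89.T3ContinuumYM3Torus in ∀ (L : ℕ) (Cth : ℝ), 0 < Cth → ∃ (Cc cc : ℝ), 0 ≤ Cc ∧ 0 < cc ∧ ∃ γ₁ : ℝ, 0 < γ₁ ∧ γ₁ ≤ 1 ∧ ∀ (F : T3Family) (γ : ℝ), F.L = L → 0 < γ → γ ≤ γ₁ → ∀ (K n : ℕ), 1 ≤ n → (n : ℝ) ≤ (F.scheme T3UnitLawDensityEML.ℰp γ).β K → 2 * n ≤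 (F.P K).sitesPerDir 0 → 17 * L ^ 3 < n → ∀ (x₀ : Site (F.P K) 0) (f : GaugeField (F.P K) 0 (Matrix.specialUnitaryGroup (Fin 2) ℂ) → ℝ) (Λ : ℝ), 0 < Λ → Measurable f → GaugeField.GaugeInvariant f → (∀ U U' : GaugeField (F.P K) 0 (Matrix.specialUnitaryGroup (Fin 2) ℂ), (∀ b : PBond (F.P K) 0, (∀ k, (b.src k - x₀ k).val < n) → (∀ k, (b.tgt k - x₀ k).val < n) → U b = U' b) → f U = f U') → (∀ U U' : GaugeField (F.P K) 0 (Matrix.specialUnitaryGroup (Fin 2) ℂ), |f U - f U'| ≤ Λ * Real.sqrt (∑ b : PBond (F.P K) 0, GaugeGroup.dist1 (U b * (U' b)⁻¹) ^ 2)) → ∀ r : ℝ, 0 ≤ r → (F.scheme T3UnitLawDensityEML.ℰp γ).β K * r ^ 2 ≤ Cth * Λ ^ 2 * (n : ℝ) ^ 5 → (T3UnitScaleTilt.gibbsK F T3UnitLawDensityEML.ℰp γ K).real {U | r ≤ f U - ∫ V, f V ∂(T3UnitScaleTilt.gibbsK F T3UnitLawDensityEML.ℰp γ K)} ≤ Cc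 * Real.exp (-(cc * (F.scheme T3UnitLawDensityEML.ℰp γ).β K * r ^ 2 / ((n : ℝ) ^ 2 * Λ ^ 2)))) :
    Summit.QuantumFields.YangMills.Theses.PoincareLipschitz.MesoscopicConcentrationL :=
  Summit.QuantumFields.YangMills.Theorems.PoincareLipschitzMesoscopicConcentrationLOfMesoscopicBox.mesoscopicConcentrationL_of_mesoscopicBox
    (mesoscopicResidual_of_moderateDeviation hMD)

end Summit.QuantumFields.YangMills.Theorems.PoincareLipschitzMesoscopicConcentrationLOfModerateDeviation
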